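import Literature.MathematicalPhysics.QuantumManyBody.GroundStateFeynmanKacOperatorProps
import Summits.AtomisticToContinuum.BoseEinsteinCondensation.Theorems.BECCutLineWeakDisorderGroundStateRigidityStubPosOfTrunc
import HarnessLib

/-!
# Crux `GroundStateRigidity` (stmt-AtomisticToContinuum-9072), line `Sketch`:
# the registered stub `stub_chainedTube`

Supports (does not close) stmt-AtomisticToContinuum-9072; stub `stub_chainedTube` of line `Sketch`.
**Chaining the segment tube bound along a polygonal chain.** Given the statement of the
neighbouring stub `stub_localTubeCore` as a hypothesis (for ONE segment `[Y, X⋆]` in the open box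
with pair clearance `b + 2m` and a measurable `A` charging every coordinate box around `X⋆`, a
lower bound `(e^{-H(w)} 1_A)(Y') ≥ c > 0` on a coordinate `δ₀`-box around `Y`, uniformly over the
measurable `w` with `w ≤ C` on `[b + m, ∞)`), the same bound holds for the `k`-fold iterate
`((e^{-H(w)})^k 1_A)(Y')` near the start `Z 0` of a chain `Z 0 → Z 1 → ⋯ → Z k` of such segments
with `A` charging every coordinate box around the end `Z k`.

Induction on `k ≥ 1` from the far end: the hypothesis on the last segment `[Z (k-1), Z k]` gives
`e^{-H} 1_A ≥ c_k` on the open coordinate box `Q` of half-width `δ_k` around `Z (k-1)` — a fixed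
measurable set charging every coordinate box around `Z (k-1)` — hence `e^{-H} 1_A ≥ c_k 1_Q`
pointwise; by monotonicity and homogeneity of the iterates (bounded measurable observables are
square integrable on the finite-volume box), `(e^{-H})^k 1_A ≥ c_k (e^{-H})^{k-1} 1_Q`, and the
induction hypothesis for the chain `Z 0, …, Z (k-1)` and the set `Q` concludes. Chung–Zhao (1995),
Thm 2.4 (chaining of tube estimates); Reed–Simon IV §XIII.12.
-/

noncomputable section

open MeasureTheory Filter Set
open scoped ENNReal NNReal Topology

namespace Summit.AtomisticToContinuum.BoseEinsteinCondensation.Theorems.GroundStateRigidity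

open Literature.MathematicalPhysics.QuantumManyBody.BoseGas

namespace ChainedTube

variable {N : ℕ}

/-! ### Bounded observables under the iterated semigroup -/

/-- **Uniform bound** `|f| ≤ M ⇒ |(e^{-tH} f)(X)| ≤ M` (the weight is `≤ 1` and the Wiener
measure is a probability measure). [folklore] -/
theorem abs_fkReal_le_of_abs_le (v : ℝ → ℝ≥0∞) (L t : ℝ) {f : Config N → ℝ} {M : ℝ}
    (hM : ∀ Y, |f Y| ≤ M) (X : Config N) : |fkReal v L t f X| ≤ M := by
  have hw1 : ∀ ω, (fkWeight v L t X ω).toReal ≤ 1 := fun ω => by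
    simpa using ENNReal.toReal_mono ENNReal.one_ne_top (fkWeight_le_one v L t X ω)
  have h := norm_integral_le_of_norm_le_const (μ := wienerPaths N) (C := M)
    (f := fun ω => (fkWeight v L t X ω).toReal * f (worldLine X ω t.toNNReal))
    (Eventually.of_forall fun ω => by
      rw [norm_mul, Real.norm_of_nonneg ENNReal.toReal_nonneg, Real.norm_eq_abs]
      calc (fkWeight v L t X ω).toReal * |f (worldLine X ω t.toNNReal)| ≤ 1 * M :=
            mul_le_mul (hw1 ω) (hM _) (abs_nonneg _) zero_le_one
        _ = M := one_mul M)
  rw [probReal_univ, mul_one, Real.norm_eq_abs] at h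
  exact h

/-- A uniformly bounded observable has finite squared `L²` mass on the (finite-volume) box.
[folklore] -/
theorem setLIntegral_sq_ne_top_of_abs_le (L : ℝ) {f : Config N → ℝ} {M : ℝ}
    (hM : ∀ Y, |f Y| ≤ M) : ∫⁻ Y in boxN N L, ‖f Y‖ₑ ^ (2 : ℝ) ≠ ⊤ := by
  have hfin : ENNReal.ofReal M ^ (2 : ℝ) * volume (boxN N L) ≠ ⊤ :=
    ENNReal.mul_ne_top (ENNReal.rpow_ne_top_of_nonneg (by norm_num) ENNReal.ofReal_ne_top)
      (volume_boxN_lt_top N L).ne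
  refine ne_top_of_le_ne_top hfin ?_
  calc ∫⁻ Y in boxN N L, ‖f Y‖ₑ ^ (2 : ℝ)
      ≤ ∫⁻ _Y in boxN N L, ENNReal.ofReal M ^ (2 : ℝ) := by
        refine lintegral_mono fun Y => ENNReal.rpow_le_rpow ?_ (by norm_num)
        rw [Real.enorm_eq_ofReal_abs]
        exact ENNReal.ofReal_le_ofReal (hM Y)
    _ = ENNReal.ofReal M ^ (2 : ℝ) * volume (boxN N L) := by rw [setLIntegral_const]

/-- Iterates of `e^{-tH}` preserve measurability (measurable `v`). [folklore] -/
theorem measurable_iterate_fkReal {v : ℝ → ℝ≥0∞} (hv : Measurable v) (L t : ℝ)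
    {f : Config N → ℝ} (hf : Measurable f) (j : ℕ) : Measurable ((fkReal v L t)^[j] f) := by
  induction j with
  | zero => simpa using hf
  | succ j ih =>
    rw [Function.iterate_succ_apply']
    exact measurable_fkReal hv L t ih

/-- Iterates of `e^{-tH}` preserve uniform bounds. [folklore] -/
theorem abs_iterate_fkReal_le (v : ℝ → ℝ≥0∞) (L t : ℝ) {f : Config N → ℝ} {M : ℝ}
    (hM : ∀ Y, |f Y| ≤ M) (j : ℕ) (X : Config N) : |(fkReal v L t)^[j] f X| ≤ M := by
  induction j generalizing X with
  | zero => simpa using hM X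
  | succ j ih =>
    rw [Function.iterate_succ_apply']
    exact abs_fkReal_le_of_abs_le v L t ih X

/-- Iterates of `e^{-tH}` preserve nonnegativity. [folklore] -/
theorem iterate_fkReal_nonneg (v : ℝ → ℝ≥0∞) (L t : ℝ) {f : Config N → ℝ}
    (hf : ∀ Y, 0 ≤ f Y) (j : ℕ) (X : Config N) : 0 ≤ (fkReal v L t)^[j] f X := by
  induction j generalizing X with
  | zero => simpa using hf X
  | succ j ih =>
    rw [Function.iterate_succ_apply']
    exact fkReal_nonneg v L t ih X

/-- **Homogeneity of the iterates**: `(e^{-tH})^j (c f) = c (e^{-tH})^j f`. [folklore] -/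
theorem iterate_fkReal_smul (v : ℝ → ℝ≥0∞) (L t : ℝ) (c : ℝ) (f : Config N → ℝ) (j : ℕ) :
    (fkReal v L t)^[j] (c • f) = c • (fkReal v L t)^[j] f := by
  induction j with
  | zero => rfl
  | succ j ih =>
    rw [Function.iterate_succ_apply', Function.iterate_succ_apply', ih]
    funext X
    rw [Pi.smul_apply, smul_eq_mul]
    exact fkReal_smul v L t c _ X

/-- **Monotonicity of the iterates** on bounded measurable observables (`t > 0`, measurable `v`):
`f ≤ g ⇒ (e^{-tH})^j f ≤ (e^{-tH})^j g` pointwise. [folklore] -/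
theorem iterate_fkReal_mono {v : ℝ → ℝ≥0∞} (hv : Measurable v) (L : ℝ) {t : ℝ} (ht : 0 < t)
    {f g : Config N → ℝ} (hf : Measurable f) (hg : Measurable g) {Mf Mg : ℝ}
    (hfM : ∀ Y, |f Y| ≤ Mf) (hgM : ∀ Y, |g Y| ≤ Mg) (hfg : ∀ Y, f Y ≤ g Y) (j : ℕ)
    (X : Config N) : (fkReal v L t)^[j] f X ≤ (fkReal v L t)^[j] g X := by
  induction j generalizing X with
  | zero => simpa using hfg X
  | succ j ih =>
    rw [Function.iterate_succ_apply', Function.iterate_succ_apply']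
    exact fkReal_mono hv L ht (measurable_iterate_fkReal hv L t hf j)
      (measurable_iterate_fkReal hv L t hg j)
      (setLIntegral_sq_ne_top_of_abs_le L (abs_iterate_fkReal_le v L t hfM j))
      (setLIntegral_sq_ne_top_of_abs_le L (abs_iterate_fkReal_le v L t hgM j)) ih X

/-- An indicator observable is bounded by `1`. [folklore] -/
theorem abs_indicator_one_le_config (A : Set (Config N)) (Y : Config N) :
    |A.indicator (fun _ => (1 : ℝ)) Y| ≤ 1 := by
  by_cases h : Y ∈ A <;> simp [h]

/-! ### Coordinate boxes -/

/-- Coordinate boxes are measurable. [folklore] -/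
theorem measurableSet_coordBox_config (Xs : Config N) (δ : ℝ) :
    MeasurableSet {Z : Config N | ∀ i k, |Z i k - Xs i k| < δ} :=
  (PosOfTrunc.isOpen_coordBox Xs δ).measurableSet

/-- Coordinate boxes of positive half-width have positive volume. [folklore] -/
theorem volume_coordBox_pos (Xs : Config N) {δ : ℝ} (hδ : 0 < δ) :
    0 < volume {Z : Config N | ∀ i k, |Z i k - Xs i k| < δ} :=
  (PosOfTrunc.isOpen_coordBox Xs δ).measure_pos volume ⟨Xs, by simp [hδ]⟩

/-- **A coordinate box charges every coordinate box with the same centre**: the intersection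
contains the box of the smaller half-width. [folklore] -/
theorem volume_coordBox_inter_pos (Xs : Config N) {δ₁ δ : ℝ} (hδ₁ : 0 < δ₁) (hδ : 0 < δ) :
    0 < volume ({Z : Config N | ∀ i k, |Z i k - Xs i k| < δ₁} ∩
      {Z : Config N | ∀ i k, |Z i k - Xs i k| < δ}) := by
  refine (volume_coordBox_pos Xs (lt_min hδ₁ hδ)).trans_le (measure_mono fun Z hZ => ?_)
  simp only [mem_inter_iff, mem_setOf_eq, lt_min_iff] at hZ ⊢
  exact ⟨fun i k => (hZ i k).1, fun i k => (hZ i k).2⟩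

end ChainedTube

/-! ### The stub -/

open ChainedTube in
/-- **Stub `stub_chainedTube` of line `Sketch` — chaining the segment tube bound along a
polygonal chain.** Assuming the one-segment tube bound (the statement of stub
`stub_localTubeCore`): for a chain `Z 0, …, Z k` (`k ≥ 1`) in the open box whose consecutive
segments have pair clearance `b + 2m`, a measurable `A` charging every coordinate box around
`Z k`, and `C`, there are `c, δ₀ > 0` with `((e^{-H(w)})^k 1_A)(Y') ≥ c` for every `Y'` within
coordinate distance `δ₀` of `Z 0` and every measurable `w` with `w ≤ C` on `[b + m, ∞)`
(induction from the far end through the intermediate open coordinate boxes, monotonicity and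
homogeneity of the iterated semigroup). [cite: ChungZhao1995, Thm 2.4] -/
theorem stub_chainedTube :
    (∀ (N : ℕ) (L b m : ℝ) (Y Xs : Config N), 0 < L → 0 ≤ b → 0 < m →
      Y ∈ boxN N L → Xs ∈ boxN N L →
      (∀ θ : ℝ, θ ∈ Set.Icc (0 : ℝ) 1 → ∀ i j : Fin N, i ≠ j →
        b + 2 * m ≤ ‖(1 - θ) • (Y i - Y j) + θ • (Xs i - Xs j)‖) →
      ∀ A : Set (Config N), MeasurableSet A →
      (∀ δ : ℝ, 0 < δ → 0 < volume (A ∩ {Z : Config N | ∀ i k, |Z i k - Xs i k| < δ})) →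
      ∀ C : ℝ≥0, ∃ c : ℝ, 0 < c ∧ ∃ δ₀ : ℝ, 0 < δ₀ ∧ ∀ w : ℝ → ℝ≥0∞, Measurable w →
        (∀ s : ℝ, b + m ≤ s → w s ≤ C) →
        ∀ Y' : Config N, (∀ i k, |Y' i k - Y i k| ≤ δ₀) →
          c ≤ fkReal w L 1 (A.indicator fun _ => (1 : ℝ)) Y') →
    ∀ (N : ℕ) (L b : ℝ), 0 < L → 0 ≤ b →
      ∀ (k : ℕ) (Z : ℕ → Config N) (m : ℝ), 0 < k → 0 < m → (∀ l : ℕ, l ≤ k → Z l ∈ boxN N L) →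
      (∀ l : ℕ, l < k → ∀ θ : ℝ, θ ∈ Set.Icc (0 : ℝ) 1 → ∀ i j : Fin N, i ≠ j →
        b + 2 * m ≤ ‖(1 - θ) • (Z l i - Z l j) + θ • (Z (l + 1) i - Z (l + 1) j)‖) →
      ∀ A : Set (Config N), MeasurableSet A →
      (∀ δ : ℝ, 0 < δ → 0 < volume (A ∩ {W : Config N | ∀ i c, |W i c - Z k i c| < δ})) →
      ∀ C : ℝ≥0, ∃ c : ℝ, 0 < c ∧ ∃ δ₀ : ℝ, 0 < δ₀ ∧ ∀ w : ℝ → ℝ≥0∞, Measurable w →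
        (∀ s : ℝ, b + m ≤ s → w s ≤ C) →
        ∀ Y' : Config N, (∀ i c, |Y' i c - Z 0 i c| ≤ δ₀) →
          c ≤ ((fkReal w L 1)^[k]) (A.indicator fun _ => (1 : ℝ)) Y' := by
  intro HT N L b hL hb k
  -- reduce to `k = n + 1` and induct on `n`, generalising the chain and the charged set
  suffices H : ∀ (n : ℕ) (Z : ℕ → Config N) (m : ℝ), 0 < m →
      (∀ l : ℕ, l ≤ n + 1 → Z l ∈ boxN N L) →
      (∀ l : ℕ, l < n + 1 → ∀ θ : ℝ, θ ∈ Set.Icc (0 : ℝ) 1 → ∀ i j : Fin N, i ≠ j →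
        b + 2 * m ≤ ‖(1 - θ) • (Z l i - Z l j) + θ • (Z (l + 1) i - Z (l + 1) j)‖) →
      ∀ A : Set (Config N), MeasurableSet A →
      (∀ δ : ℝ, 0 < δ → 0 < volume (A ∩ {W : Config N | ∀ i c, |W i c - Z (n + 1) i c| < δ})) →
      ∀ C : ℝ≥0, ∃ c : ℝ, 0 < c ∧ ∃ δ₀ : ℝ, 0 < δ₀ ∧ ∀ w : ℝ → ℝ≥0∞, Measurable w →
        (∀ s : ℝ, b + m ≤ s → w s ≤ C) →
        ∀ Y' : Config N, (∀ i c, |Y' i c - Z 0 i c| ≤ δ₀) →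
          c ≤ ((fkReal w L 1)^[n + 1]) (A.indicator fun _ => (1 : ℝ)) Y' by
    intro Z m hk hm hZ hseg A hA hch C
    obtain ⟨n, rfl⟩ : ∃ n, k = n + 1 := ⟨k - 1, by omega⟩
    exact H n Z m hm hZ hseg A hA hch C
  intro n
  induction n with
  | zero =>
    -- one segment: the hypothesis itself
    intro Z m hm hZ hseg A hA hch C
    obtain ⟨c, hc, δ₀, hδ₀, Hc⟩ := HT N L b m (Z 0) (Z (0 + 1)) hL hb hm (hZ 0 (Nat.zero_le _))
      (hZ (0 + 1) le_rfl) (hseg 0 Nat.one_pos) A hA hch C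
    refine ⟨c, hc, δ₀, hδ₀, fun w hw hwC Y' hY' => ?_⟩
    rw [Nat.zero_add, Function.iterate_one]
    exact Hc w hw hwC Y' hY'
  | succ n ih =>
    intro Z m hm hZ hseg A hA hch C
    -- the last segment `[Z (n+1), Z (n+2)]` with the set `A`
    obtain ⟨c₁, hc₁, δ₁, hδ₁, H₁⟩ := HT N L b m (Z (n + 1)) (Z (n + 1 + 1)) hL hb hm
      (hZ (n + 1) (Nat.le_succ _)) (hZ (n + 1 + 1) le_rfl) (hseg (n + 1) (Nat.lt_succ_self _))
      A hA hch C
    -- the open coordinate box `Q` around `Z (n+1)` on which `e^{-H} 1_A ≥ c₁`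
    set Q : Set (Config N) := {W : Config N | ∀ i c, |W i c - Z (n + 1) i c| < δ₁} with hQdef
    have hQm : MeasurableSet Q := measurableSet_coordBox_config (Z (n + 1)) δ₁
    have hQch : ∀ δ : ℝ, 0 < δ →
        0 < volume (Q ∩ {W : Config N | ∀ i c, |W i c - Z (n + 1) i c| < δ}) :=
      fun δ hδ => volume_coordBox_inter_pos (Z (n + 1)) hδ₁ hδ
    -- the induction hypothesis for the chain `Z 0, …, Z (n+1)` and the set `Q`
    obtain ⟨c', hc', δ₀, hδ₀, H'⟩ := ih Z m hm (fun l hl => hZ l (Nat.le_succ_of_le hl))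
      (fun l hl => hseg l (Nat.lt_succ_of_lt hl)) Q hQm hQch C
    refine ⟨c₁ * c', mul_pos hc₁ hc', δ₀, hδ₀, fun w hw hwC Y' hY' => ?_⟩
    rw [Function.iterate_succ_apply]
    -- the observables `c₁ 1_Q ≤ e^{-H} 1_A`, bounded and measurable
    set g : Config N → ℝ := fkReal w L 1 (A.indicator fun _ => (1 : ℝ)) with hgdef
    set f : Config N → ℝ := c₁ • Q.indicator fun _ => (1 : ℝ) with hfdef
    have hgm : Measurable g := measurable_fkReal hw L 1 (measurable_const.indicator hA)
    have hfm : Measurable f := (measurable_const.indicator hQm).const_smul c₁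
    have hgM : ∀ Y, |g Y| ≤ 1 := fun Y =>
      abs_fkReal_le_of_abs_le w L 1 (abs_indicator_one_le_config A) Y
    have hfM : ∀ Y, |f Y| ≤ c₁ := fun Y => by
      rw [hfdef, Pi.smul_apply, smul_eq_mul, abs_mul, abs_of_pos hc₁]
      exact mul_le_of_le_one_right hc₁.le (abs_indicator_one_le_config Q Y)
    have hfg : ∀ Y, f Y ≤ g Y := fun Y => by
      rw [hfdef, Pi.smul_apply, smul_eq_mul]
      by_cases hY : Y ∈ Q
      · rw [Set.indicator_of_mem hY, mul_one]
        exact H₁ w hw hwC Y fun i c => (hY i c).le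
      · rw [Set.indicator_of_notMem hY, mul_zero]
        exact fkReal_nonneg w L 1 (fun W => Set.indicator_nonneg (fun _ _ => zero_le_one) W) Y
    calc c₁ * c' ≤ c₁ * ((fkReal w L 1)^[n + 1]) (Q.indicator fun _ => (1 : ℝ)) Y' :=
          mul_le_mul_of_nonneg_left (H' w hw hwC Y' hY') hc₁.le
      _ = ((fkReal w L 1)^[n + 1]) f Y' := by
          rw [hfdef, iterate_fkReal_smul, Pi.smul_apply, smul_eq_mul]
      _ ≤ ((fkReal w L 1)^[n + 1]) g Y' :=
          iterate_fkReal_mono hw L one_pos hfm hgm hfM hgM hfg (n + 1) Y'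

end Summit.AtomisticToContinuum.BoseEinsteinCondensation.Theorems.GroundStateRigidity

end
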